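import Summits.ValiantsHypothesis.ValiantsHypothesis.Theorems.LacunarySymmetroidMatrixDescartesFanLawThree

/-!
# `MatrixDescartes` (stmt-ValiantsHypothesis-18050), line `Lift` — the closed-window fan law WITHOUT definiteness,
# in ALTERNATION currency: on the closed kernel window `det F` has at most `2 · card ι` sign alternations on `(0, ∞)`

HONEST FRAMING.  Cell `pub-symmetroid`, seat `val-sym-mdr-p2` (gen 3); helper `--supports` the crux
`Theses.LacunarySymmetroid.MatrixDescartes`, NO closure claim.  Companion of `…FanLawThree.lean` (closed-window fan
law: boundary letters positive DEFINITE ⇒ `Z₊ ≤ 2·card ι`).  Nothing here bears on `stub_twoSided` in general, the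
crux in its window, `DoorA26`/`DoorA34`, or `VP ≠ VNP`.

WHAT IS PROVED.  `F(X) = X^e J + ∑ k, X^{d k} P k`, `J` real symmetric, ALL `P k ⪰ 0` (no definiteness anywhere), a
factoring letter `k₀` with gap `a`, every other letter in the CLOSED window (opposite side gap `≤ a`, same side gap in
`(a, 2a]`).  Then `det F` cannot alternate in sign along more than `2 · card ι + 1` positive points: if
`0 < τ₀ < ⋯ < τ_N` and `det F(τ_j) · det F(τ_{j+1}) < 0` for all `j`, then `N ≤ 2 · card ι`
(`fanLawThreeAlt_lower`, `fanLawThreeAlt_upper`).  Consequently every positive zero of ODD multiplicity is counted by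
the law; only zeros of even multiplicity could exceed `2 · card ι` at a semidefinite boundary — and every `> 2n`
witness of record in the cell is a sign-alternation certificate (`le_card_posRoots_of_alternating`), so no such
certificate exists on the closed window.
PROOF.  Perturb every letter `P k ↦ P k + ε·1` (`ε > 0`): the exponents are unchanged and every letter becomes
positive definite, so `…FanLawThree` applies to `F_ε`; the finitely many signs `det F_ε(τ_j)` depend continuously on
`ε` (`Continuous.matrix_det`), hence agree with those of `det F(τ_j)` for small `ε > 0`; the alternation then gives
`N ≤ Z₊(F_ε) ≤ 2·card ι` by the tree lemma `SymmetroidDescartes.le_card_posRoots_of_alternating` (IVT).  [folklore]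
-/

-- layout Summits/ValiantsHypothesis/ValiantsHypothesis forces the duplicated namespace component
set_option linter.dupNamespace false

namespace Summit.ValiantsHypothesis.ValiantsHypothesis.Theorems.LacunarySymmetroidMatrixDescartes

open Polynomial Matrix Finset Filter Topology
open scoped BigOperators
open Summit.ValiantsHypothesis.ValiantsHypothesis.Theorems.SymmetroidDescartes (le_card_posRoots_of_alternating)

namespace FanLawThreeAlt

variable {ι : Type} [Fintype ι] [DecidableEq ι] {κ : Type} [Fintype κ] [DecidableEq κ]

omit [DecidableEq κ] in
/-- The `ε`-perturbed pencil evaluated at `t`: `det (t^e J + ∑ t^{d k} (P k + ε·1))` is a continuous function of `ε`.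
[folklore] -/
theorem continuous_det_perturbed (e : ℕ) (d : κ → ℕ) (J : Matrix ι ι ℝ) (P : κ → Matrix ι ι ℝ) (t : ℝ) :
    Continuous fun ε : ℝ => Matrix.det (t ^ e • J + ∑ k, t ^ d k • (P k + ε • (1 : Matrix ι ι ℝ))) := by
  have h : (fun ε : ℝ => t ^ e • J + ∑ k, t ^ d k • (P k + ε • (1 : Matrix ι ι ℝ)))
      = fun ε : ℝ => (t ^ e • J + ∑ k, t ^ d k • P k) + ε • ∑ k, t ^ d k • (1 : Matrix ι ι ℝ) := by
    funext ε
    simp only [smul_add, Finset.sum_add_distrib, Finset.smul_sum, smul_comm (t ^ _) ε]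
    abel
  refine Continuous.matrix_det ?_
  rw [h]
  exact continuous_const.add (continuous_id.smul continuous_const)

omit [DecidableEq κ] in
/-- **Alternations are bounded by the perturbed root budget.**  If for every `ε > 0` the pencil with letters
`P k + ε·1` has at most `B` distinct positive determinant zeros, then `det (X^e J + ∑ X^{d k} P k)` alternates in sign
along at most `B + 1` positive points. [folklore] -/
theorem alternation_le_of_perturbed (e : ℕ) (d : κ → ℕ) (J : Matrix ι ι ℝ) (P : κ → Matrix ι ι ℝ) (B : ℕ)
    (hB : ∀ ε : ℝ, 0 < ε →
      ((Matrix.det (((Polynomial.X : Polynomial ℝ) ^ e) • J.map Polynomial.C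
        + ∑ k, ((Polynomial.X : Polynomial ℝ) ^ d k) • (P k + ε • (1 : Matrix ι ι ℝ)).map Polynomial.C)
          ).roots.toFinset.filter (fun t => 0 < t)).card ≤ B)
    (N : ℕ) (τ : Fin (N + 1) → ℝ) (hτ : StrictMono τ) (hτpos : ∀ j, 0 < τ j)
    (halt : ∀ j : Fin N,
      (Matrix.det (((Polynomial.X : Polynomial ℝ) ^ e) • J.map Polynomial.C
        + ∑ k, ((Polynomial.X : Polynomial ℝ) ^ d k) • (P k).map Polynomial.C)).eval (τ j.castSucc)
      * (Matrix.det (((Polynomial.X : Polynomial ℝ) ^ e) • J.map Polynomial.C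
        + ∑ k, ((Polynomial.X : Polynomial ℝ) ^ d k) • (P k).map Polynomial.C)).eval (τ j.succ) < 0) :
    N ≤ B := by
  -- the sign data in terms of real determinants
  set g : ℝ → ℝ → ℝ := fun ε t =>
    Matrix.det (t ^ e • J + ∑ k, t ^ d k • (P k + ε • (1 : Matrix ι ι ℝ))) with hg
  have hg0 : ∀ t, g 0 t = Matrix.det (t ^ e • J + ∑ k, t ^ d k • P k) := by
    intro t
    simp [hg]
  have halt0 : ∀ j : Fin N, g 0 (τ j.castSucc) * g 0 (τ j.succ) < 0 := by
    intro j
    have h := halt j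
    rwa [StubReverse.eval_det_pencil, StubReverse.eval_det_pencil, ← hg0, ← hg0] at h
  -- continuity in `ε` at each of the finitely many gaps
  have hev : ∀ j : Fin N, ∀ᶠ ε in 𝓝 (0 : ℝ), g ε (τ j.castSucc) * g ε (τ j.succ) < 0 := by
    intro j
    have hc : Continuous fun ε : ℝ => g ε (τ j.castSucc) * g ε (τ j.succ) :=
      (continuous_det_perturbed e d J P _).mul (continuous_det_perturbed e d J P _)
    exact hc.continuousAt.eventually_lt continuousAt_const (halt0 j)
  have hall : ∀ᶠ ε in 𝓝 (0 : ℝ), ∀ j : Fin N, g ε (τ j.castSucc) * g ε (τ j.succ) < 0 :=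
    Filter.eventually_all.2 hev
  -- a positive `ε` in that neighbourhood
  have hpos : ∀ᶠ ε in 𝓝[>] (0 : ℝ), (∀ j : Fin N, g ε (τ j.castSucc) * g ε (τ j.succ) < 0) ∧ 0 < ε :=
    (hall.filter_mono nhdsWithin_le_nhds).and self_mem_nhdsWithin
  obtain ⟨ε, hεalt, hε⟩ := hpos.exists
  -- alternation of the perturbed determinant, hence `N` positive roots, hence `N ≤ B`
  have haltε : ∀ j : Fin N,
      (Matrix.det (((Polynomial.X : Polynomial ℝ) ^ e) • J.map Polynomial.C
        + ∑ k, ((Polynomial.X : Polynomial ℝ) ^ d k) • (P k + ε • (1 : Matrix ι ι ℝ)).map Polynomial.C)).eval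
          (τ j.castSucc)
      * (Matrix.det (((Polynomial.X : Polynomial ℝ) ^ e) • J.map Polynomial.C
        + ∑ k, ((Polynomial.X : Polynomial ℝ) ^ d k) • (P k + ε • (1 : Matrix ι ι ℝ)).map Polynomial.C)).eval
          (τ j.succ) < 0 := by
    intro j
    rw [StubReverse.eval_det_pencil, StubReverse.eval_det_pencil]
    exact hεalt j
  exact (le_card_posRoots_of_alternating _ N τ hτ hτpos haltε).trans (hB ε hε)

/-- **Closed-window lower fan law, alternation form (no definiteness).**  Factoring letter `k₀` below the pivot,
gap `a = e − d k₀ > 0`; every other letter above with gap `≤ a` or below with gap in `(a, 2a]`; all letters `⪰ 0`.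
Then `det F` has at most `2 · card ι` sign alternations along positive points. [folklore] -/
theorem fanLawThreeAlt_lower (e : ℕ) (d : κ → ℕ) (J : Matrix ι ι ℝ) (P : κ → Matrix ι ι ℝ) (k₀ : κ)
    (hJ : J.IsSymm) (hP : ∀ k, (P k).PosSemidef) (hlow : d k₀ < e)
    (hfan : ∀ k, k ≠ k₀ → (e < d k ∧ d k - e ≤ e - d k₀)
      ∨ (d k < e ∧ e - d k₀ < e - d k ∧ e - d k ≤ 2 * (e - d k₀)))
    (N : ℕ) (τ : Fin (N + 1) → ℝ) (hτ : StrictMono τ) (hτpos : ∀ j, 0 < τ j)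
    (halt : ∀ j : Fin N,
      (Matrix.det (((Polynomial.X : Polynomial ℝ) ^ e) • J.map Polynomial.C
        + ∑ k, ((Polynomial.X : Polynomial ℝ) ^ d k) • (P k).map Polynomial.C)).eval (τ j.castSucc)
      * (Matrix.det (((Polynomial.X : Polynomial ℝ) ^ e) • J.map Polynomial.C
        + ∑ k, ((Polynomial.X : Polynomial ℝ) ^ d k) • (P k).map Polynomial.C)).eval (τ j.succ) < 0) :
    N ≤ 2 * Fintype.card ι := by
  refine alternation_le_of_perturbed e d J P _ (fun ε hε => ?_) N τ hτ hτpos halt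
  have hPε : ∀ k, (P k + ε • (1 : Matrix ι ι ℝ)).PosDef := fun k =>
    Matrix.PosDef.posSemidef_add (hP k) (Matrix.PosDef.one.smul hε)
  refine FanLawThree.fanLawThree_lower e d J (fun k => P k + ε • (1 : Matrix ι ι ℝ)) k₀ hJ
    (fun k => (hPε k).posSemidef) hlow fun k hk => ?_
  rcases hfan k hk with ⟨h1, h2⟩ | ⟨h1, h2, h3⟩
  · rcases Nat.lt_or_eq_of_le h2 with h | h
    · exact Or.inl ⟨h1, h⟩
    · exact Or.inr (Or.inl ⟨by omega, hPε k⟩)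
  · rcases Nat.lt_or_eq_of_le h3 with h | h
    · exact Or.inr (Or.inr (Or.inl ⟨h1, h2, h⟩))
    · exact Or.inr (Or.inr (Or.inr ⟨by omega, hPε k⟩))

/-- **Closed-window upper fan law, alternation form (no definiteness).**  Factoring letter `k₀` above the pivot,
gap `a = d k₀ − e > 0`; every other letter below with gap `≤ a` or above with gap in `(a, 2a]`; all letters `⪰ 0`.
Then `det F` has at most `2 · card ι` sign alternations along positive points. [folklore] -/
theorem fanLawThreeAlt_upper (e : ℕ) (d : κ → ℕ) (J : Matrix ι ι ℝ) (P : κ → Matrix ι ι ℝ) (k₀ : κ)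
    (hJ : J.IsSymm) (hP : ∀ k, (P k).PosSemidef) (hup : e < d k₀)
    (hfan : ∀ k, k ≠ k₀ → (d k < e ∧ e - d k ≤ d k₀ - e)
      ∨ (e < d k ∧ d k₀ - e < d k - e ∧ d k - e ≤ 2 * (d k₀ - e)))
    (N : ℕ) (τ : Fin (N + 1) → ℝ) (hτ : StrictMono τ) (hτpos : ∀ j, 0 < τ j)
    (halt : ∀ j : Fin N,
      (Matrix.det (((Polynomial.X : Polynomial ℝ) ^ e) • J.map Polynomial.C
        + ∑ k, ((Polynomial.X : Polynomial ℝ) ^ d k) • (P k).map Polynomial.C)).eval (τ j.castSucc)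
      * (Matrix.det (((Polynomial.X : Polynomial ℝ) ^ e) • J.map Polynomial.C
        + ∑ k, ((Polynomial.X : Polynomial ℝ) ^ d k) • (P k).map Polynomial.C)).eval (τ j.succ) < 0) :
    N ≤ 2 * Fintype.card ι := by
  refine alternation_le_of_perturbed e d J P _ (fun ε hε => ?_) N τ hτ hτpos halt
  have hPε : ∀ k, (P k + ε • (1 : Matrix ι ι ℝ)).PosDef := fun k =>
    Matrix.PosDef.posSemidef_add (hP k) (Matrix.PosDef.one.smul hε)
  refine FanLawThree.fanLawThree_upper e d J (fun k => P k + ε • (1 : Matrix ι ι ℝ)) k₀ hJ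
    (fun k => (hPε k).posSemidef) hup fun k hk => ?_
  rcases hfan k hk with ⟨h1, h2⟩ | ⟨h1, h2, h3⟩
  · rcases Nat.lt_or_eq_of_le h2 with h | h
    · exact Or.inl ⟨h1, h⟩
    · exact Or.inr (Or.inl ⟨by omega, hPε k⟩)
  · rcases Nat.lt_or_eq_of_le h3 with h | h
    · exact Or.inr (Or.inr (Or.inl ⟨h1, h2, h⟩))
    · exact Or.inr (Or.inr (Or.inr ⟨by omega, hPε k⟩))

end FanLawThreeAlt

open FanLawThreeAlt

/-- **Closed fan words, alternation form (no definiteness)** (crux currency).  `∑ₗ X^{dₗ} Sₗ` with pivot `lp`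
symmetric, all other letters `⪰ 0`, a factoring letter `lf ≠ lp` with gap `a > 0`, every other letter opposite the
pivot with gap `≤ a` or on the factoring side with gap in `(a, 2a]`: the determinant alternates in sign along at
most `2m + 1` positive points. [folklore] -/
theorem fanWordThree_alternation_le (K m : ℕ) (d : Fin K → ℕ) (S : Fin K → Matrix (Fin m) (Fin m) ℝ)
    (lp lf : Fin K) (hne : lf ≠ lp) (hS : (S lp).IsSymm) (hpsd : ∀ l, l ≠ lp → (S l).PosSemidef)
    (hfan : (d lf < d lp ∧ ∀ l, l ≠ lp → l ≠ lf → (d lp < d l ∧ d l - d lp ≤ d lp - d lf)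
        ∨ (d l < d lp ∧ d lp - d lf < d lp - d l ∧ d lp - d l ≤ 2 * (d lp - d lf)))
      ∨ (d lp < d lf ∧ ∀ l, l ≠ lp → l ≠ lf → (d l < d lp ∧ d lp - d l ≤ d lf - d lp)
        ∨ (d lp < d l ∧ d lf - d lp < d l - d lp ∧ d l - d lp ≤ 2 * (d lf - d lp))))
    (N : ℕ) (τ : Fin (N + 1) → ℝ) (hτ : StrictMono τ) (hτpos : ∀ j, 0 < τ j)
    (halt : ∀ j : Fin N,
      (Matrix.det (∑ l, ((Polynomial.X : Polynomial ℝ) ^ d l) • (S l).map Polynomial.C)).eval (τ j.castSucc)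
      * (Matrix.det (∑ l, ((Polynomial.X : Polynomial ℝ) ^ d l) • (S l).map Polynomial.C)).eval (τ j.succ)
        < 0) :
    N ≤ 2 * m := by
  classical
  have hsplit : ∑ l, ((Polynomial.X : Polynomial ℝ) ^ d l) • (S l).map Polynomial.C
      = ((Polynomial.X : Polynomial ℝ) ^ d lp) • (S lp).map Polynomial.C
        + ∑ l : {l // l ≠ lp}, ((Polynomial.X : Polynomial ℝ) ^ d l.1) • (S l.1).map Polynomial.C := by
    rw [← Finset.add_sum_erase _ _ (Finset.mem_univ lp),
      Finset.sum_subtype (Finset.univ.erase lp) (p := fun l => l ≠ lp) (fun l => by simp [Finset.mem_erase])]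
  rw [hsplit] at halt
  have hP : ∀ l : {l // l ≠ lp}, (S l.1).PosSemidef := fun l => hpsd l.1 l.2
  rcases hfan with ⟨hlow, h⟩ | ⟨hup, h⟩
  · have := fanLawThreeAlt_lower (κ := {l // l ≠ lp}) (d lp) (fun l => d l.1) (S lp) (fun l => S l.1) ⟨lf, hne⟩
      hS hP hlow (fun l hl => h l.1 l.2 fun hll => hl (Subtype.ext hll)) N τ hτ hτpos halt
    simpa using this
  · have := fanLawThreeAlt_upper (κ := {l // l ≠ lp}) (d lp) (fun l => d l.1) (S lp) (fun l => S l.1) ⟨lf, hne⟩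
      hS hP hup (fun l hl => h l.1 l.2 fun hll => hl (Subtype.ext hll)) N τ hτ hτpos halt
    simpa using this

end Summit.ValiantsHypothesis.ValiantsHypothesis.Theorems.LacunarySymmetroidMatrixDescartes
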